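import Literature.MathematicalPhysics.QuantumLattice.DWaveSourceEnergyDensityRowReaders
import HarnessLib

/-!
# Transport of the sourced energy density `e_src(t', U, μ, h)` across the chemical potential and the
# repulsion: monotonicity, Lipschitz constants, tangents at ground states; chords on thermodynamic-limit
# ground states from certified bounds

Topic `Literature/MathematicalPhysics/QuantumLattice` (family `hubbard`); sequel of
`DWaveSourceEnergyDensityEnsembles.lean` / `…RowReaders.lean` (the torus-limit energy density
`e_src(t',U,μ,h) = dWaveSourceEnergyDensityTT' t' U μ h` of the `d`-wave pair-sourced `t–t'` Hubbard torus is the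
minimum of the sourced mean energy `E(ω) = e^{1,t',U}(ω) − μρ(ω) − h·2Re ω(P₀^d)` over translation-invariant
states, attained at torus-limit ground states). Written for the pinning-field menus of the Hubbard cuprate cell
(`hubbard-cq`), whose legs sit at several chemical potentials (`μ ∈ {3/2, 7/4, 2}`, the tangent `μ*` of the
canonical anchor) and two couplings: the concavity rules of `DWaveSourceEnergyDensityCouplings.lean` move
certified windows INSIDE the convex hull of anchors; the rules here move them from ONE anchor (the box rules of the
material-oracle layer, `HubbardTTPrimeGrandCanonicalEnergyDensity` §3, for the SOURCED object at every `h`).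

* §1 CHORDS FROM BOUNDS on thermodynamic-limit ground states: for every torus limit `ω` of unit ground-state
  vectors of `A_L(t',U,μ,h)`, real bounds `lo₁ ≤ e_src(h₁)` (`h₁ < h`) and `e_src(h) ≤ hi` give
  `(lo₁ − hi)/(2(h − h₁)) ≤ Re ω(P₀^d)`; `e_src(h) ≤ hi`, `lo₂ ≤ e_src(h₂)` (`h₂ > h`) give
  `Re ω(P₀^d) ≤ (hi − lo₂)/(2(h₂ − h))`; and THE GRAND-CANONICAL-ROUTE NODE: an all-density canonical tangent
  `c + μm ≤ energyDensityTT' 1 t' U m` plus one sourced cap `e_src(t',U,μ,h) ≤ hi` give `(c − hi)/(2h) ≤ Re ω(P₀^d)`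
  for every torus-limit ground state at `(μ, h)` — no density hypothesis on `ω`.
* §2 THE `μ`-DIRECTION: `e_src` is non-increasing in `μ` and `2`-Lipschitz (`0 ≤ ρ ≤ 2`); the tangent at a
  torus-limit ground state `e_src(μ') ≤ e_src(μ) − (μ' − μ)ρ(ω)`; window transport (a floor moves to SMALLER `μ`
  for free and to larger `μ` at slope `2`; a ceiling moves to LARGER `μ` for free).
* §3 THE `U`-DIRECTION: `e_src` is non-decreasing in `U` (every real `U ≤ U'`) and `1`-Lipschitz (the
  double-occupancy density lies in `[0, 1]`); the tangent `e_src(U') ≤ e_src(U) + (U' − U)·D(ω)`; window transport.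

Everything is PROVED; no definition, no named fact. HONEST SCOPE: plumbing; a bound on the induced pair amplitude
at fixed `h > 0` is symmetry-allowed response, not order.

## References
* R. B. Israel, *Convexity in the Theory of Lattice Gases* (1979), Thm. I.3.4 (the thermodynamic function is
  `1`-Lipschitz in the interaction norm; tangent functionals). [cite: Israel1979, Thm. I.3.4]
* D. Ruelle, *Statistical Mechanics: Rigorous Results* (1969), §3.4. [cite: Ruelle1969, §3.4]
* R. B. Griffiths, Phys. Rev. 152 (1966) 240, §II. [cite: Griffiths1966, §II]
* T. Koma, H. Tasaki, J. Stat. Phys. 76 (1994) 745, §1. [cite: KomaTasaki1994, §1]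
-/

noncomputable section

namespace Literature.MathematicalPhysics.QuantumLattice

open _root_.Matrix Finset HubbardWave0 Literature.Probability.LatticeModels _root_.Filter ThermodynamicLimit
open scoped _root_.Topology ComplexOrder BigOperators

/-! ### §1 Chords on thermodynamic-limit ground states from certified bounds -/

section Chords

variable {ω : InfVolFermionState 2} {ψ : ∀ L, Fock (Orb (FermionTorus 2 L))} {Ls : ℕ → ℕ}

/-- **FLOOR on the induced pair amplitude of a thermodynamic-limit ground state from two certified numbers**:
for a torus limit `ω` of unit ground-state vectors of `A_L(t',U,μ,h)`, a floor `lo₁ ≤ e_src(t',U,μ,h₁)` at a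
smaller field `h₁ < h` and a ceiling `e_src(t',U,μ,h) ≤ hi` give `(lo₁ − hi)/(2(h − h₁)) ≤ Re ω(P₀^d)`.
[cite: KomaTasaki1994, §1] -/
theorem InfVolFermionState.IsTorusLimitOf.re_expect_localPairAt_ge_of_energyDensity_bounds
    [hL0 : ∀ j, NeZero (Ls j)] (hω : ω.IsTorusLimitOf ψ Ls) (hLs : Tendsto Ls atTop atTop)
    (hψ : ∀ j, star (ψ (Ls j)) ⬝ᵥ ψ (Ls j) = 1) (t' U μ h : ℝ)
    (hgs : ∀ j, dWaveSourceTorusTT' (Ls j) t' U μ h *ᵥ ψ (Ls j) =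
      ((Matrix.groundEnergy (dWaveSourceTorusTT' (Ls j) t' U μ h) : ℝ) : ℂ) • ψ (Ls j))
    {h₁ lo₁ hi : ℝ} (hlt : h₁ < h) (hlo : lo₁ ≤ dWaveSourceEnergyDensityTT' t' U μ h₁)
    (hhi : dWaveSourceEnergyDensityTT' t' U μ h ≤ hi) :
    (lo₁ - hi) / (2 * (h - h₁)) ≤
      (ω.expect (pairRegion (insert (0 : Site 2) unitSteps) 0)
        (localPairAt (insert 0 unitSteps) dWaveFormFactor 0)).re := by
  have hδ : 0 < h - h₁ := sub_pos.2 hlt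
  obtain ⟨hsec, -⟩ := hω.two_mul_re_expect_localPairAt_mem_secant_brackets hLs hψ t' U μ h hgs hδ
  rw [show h - (h - h₁) = h₁ by ring] at hsec
  have h3 : (lo₁ - hi) / (h - h₁) ≤
      (dWaveSourceEnergyDensityTT' t' U μ h₁ - dWaveSourceEnergyDensityTT' t' U μ h) / (h - h₁) :=
    div_le_div_of_nonneg_right (by linarith) hδ.le
  rw [mul_comm, ← div_div]
  linarith [h3.trans hsec]

/-- **CEILING from two certified numbers**: a ceiling `e_src(t',U,μ,h) ≤ hi` and a floor `lo₂ ≤ e_src(t',U,μ,h₂)`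
at a larger field `h₂ > h` give `Re ω(P₀^d) ≤ (hi − lo₂)/(2(h₂ − h))` for every torus-limit ground state at
`(μ, h)`. A ceiling; never speaks to presence. [cite: KomaTasaki1994, §1] -/
theorem InfVolFermionState.IsTorusLimitOf.re_expect_localPairAt_le_of_energyDensity_bounds
    [hL0 : ∀ j, NeZero (Ls j)] (hω : ω.IsTorusLimitOf ψ Ls) (hLs : Tendsto Ls atTop atTop)
    (hψ : ∀ j, star (ψ (Ls j)) ⬝ᵥ ψ (Ls j) = 1) (t' U μ h : ℝ)
    (hgs : ∀ j, dWaveSourceTorusTT' (Ls j) t' U μ h *ᵥ ψ (Ls j) =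
      ((Matrix.groundEnergy (dWaveSourceTorusTT' (Ls j) t' U μ h) : ℝ) : ℂ) • ψ (Ls j))
    {h₂ lo₂ hi : ℝ} (hlt : h < h₂) (hhi : dWaveSourceEnergyDensityTT' t' U μ h ≤ hi)
    (hlo : lo₂ ≤ dWaveSourceEnergyDensityTT' t' U μ h₂) :
    (ω.expect (pairRegion (insert (0 : Site 2) unitSteps) 0)
        (localPairAt (insert 0 unitSteps) dWaveFormFactor 0)).re ≤ (hi - lo₂) / (2 * (h₂ - h)) := by
  have hδ : 0 < h₂ - h := sub_pos.2 hlt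
  obtain ⟨-, hsec⟩ := hω.two_mul_re_expect_localPairAt_mem_secant_brackets hLs hψ t' U μ h hgs hδ
  rw [show h + (h₂ - h) = h₂ by ring] at hsec
  have h3 : (dWaveSourceEnergyDensityTT' t' U μ h - dWaveSourceEnergyDensityTT' t' U μ h₂) / (h₂ - h) ≤
      (hi - lo₂) / (h₂ - h) :=
    div_le_div_of_nonneg_right (by linarith) hδ.le
  rw [mul_comm, ← div_div]
  linarith [hsec.trans h3]

/-- **The grand-canonical-route node on thermodynamic-limit ground states.** An all-density canonical
TANGENT `c + μm ≤ energyDensityTT' 1 t' U m` (`m ∈ [0,2)`; e.g. a canonical certificate read uniformly in its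
density right-hand side) and ONE sourced cap `e_src(t',U,μ,h) ≤ hi` at `h > 0` give, for EVERY torus limit `ω` of
unit ground-state vectors of `A_L(t',U,μ,h)` (no density hypothesis on `ω`), the finite-field response floor
`(c − hi)/(2h) ≤ Re ω(P₀^d)` (`U ≥ 0`). [cite: Griffiths1966, §II] -/
theorem InfVolFermionState.IsTorusLimitOf.re_expect_localPairAt_ge_of_forall_tangent
    [hL0 : ∀ j, NeZero (Ls j)] (hω : ω.IsTorusLimitOf ψ Ls) (hLs : Tendsto Ls atTop atTop)
    (hψ : ∀ j, star (ψ (Ls j)) ⬝ᵥ ψ (Ls j) = 1) (t' : ℝ) {U : ℝ} (hU : 0 ≤ U) (μ : ℝ) {h : ℝ} (hh : 0 < h)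
    (hgs : ∀ j, dWaveSourceTorusTT' (Ls j) t' U μ h *ᵥ ψ (Ls j) =
      ((Matrix.groundEnergy (dWaveSourceTorusTT' (Ls j) t' U μ h) : ℝ) : ℂ) • ψ (Ls j))
    {c hi : ℝ} (hc : ∀ m : ℝ, 0 ≤ m → m < 2 → c + μ * m ≤ energyDensityTT' 1 t' U m)
    (hhi : dWaveSourceEnergyDensityTT' t' U μ h ≤ hi) :
    (c - hi) / (2 * h) ≤
      (ω.expect (pairRegion (insert (0 : Site 2) unitSteps) 0)
        (localPairAt (insert 0 unitSteps) dWaveFormFactor 0)).re := by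
  have h0 := le_dWaveSourceEnergyDensityTT'_zero_of_forall_tangent t' hU hc (μ := μ)
  have h1 := hω.re_expect_localPairAt_ge_of_energyDensity_bounds hLs hψ t' U μ h hgs hh h0 hhi
  rwa [sub_zero] at h1

end Chords

/-! ### §2 The `μ`-direction: monotone, `2`-Lipschitz, tangents, window transport -/

section Mu

variable (t' U h : ℝ)

/-- **Tangent inequality in `μ` at any translation-invariant state attaining `e_src(μ)`**: if `ω` is translation
invariant with sourced mean energy `E^{μ}_h(ω) = e_src(t',U,μ,h)`, then for every `μ'`,
`e_src(t',U,μ',h) ≤ e_src(t',U,μ,h) − (μ' − μ)·ρ(ω)` (`ω` is a trial state at `μ'`; `E^{μ'} = E^{μ} − (μ'−μ)ρ`).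
[cite: Israel1979, Thm. I.3.4] -/
theorem dWaveSourceEnergyDensityTT'_le_sub_mul_density_of_minimiser {μ : ℝ} {ω : InfVolFermionState 2}
    (hω : ω.IsTranslationInvariant)
    (hmin : ω.meanEnergy (hubbardTTPrimeSourcedInteraction 1 t' U μ dWaveFormFactor h) 1 =
      dWaveSourceEnergyDensityTT' t' U μ h) (μ' : ℝ) :
    dWaveSourceEnergyDensityTT' t' U μ' h ≤ dWaveSourceEnergyDensityTT' t' U μ h - (μ' - μ) * ω.density := by
  have h1 := dWaveSourceEnergyDensityTT'_le_meanEnergy_sourced t' U μ' h hω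
  rw [InfVolFermionState.meanEnergy_hubbardTTPrimeSourced] at h1 hmin
  linarith

/-- **Tangent in `μ` at a thermodynamic-limit ground state**: for every torus limit `ω` of unit ground-state
vectors of `A_L(t',U,μ,h)` and every `μ'`, `e_src(t',U,μ',h) ≤ e_src(t',U,μ,h) − (μ' − μ)·ρ(ω)` — with a certified
density bracket for `ω` this transports a ceiling at `μ` to a ceiling at `μ'` sharper than the Lipschitz rule.
[cite: Israel1979, Thm. I.3.4] -/
theorem InfVolFermionState.IsTorusLimitOf.dWaveSourceEnergyDensityTT'_le_tangent_mu
    {ω : InfVolFermionState 2} {ψ : ∀ L, Fock (Orb (FermionTorus 2 L))} {Ls : ℕ → ℕ}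
    [hL0 : ∀ j, NeZero (Ls j)] (hω : ω.IsTorusLimitOf ψ Ls) (hLs : Tendsto Ls atTop atTop)
    (hψ : ∀ j, star (ψ (Ls j)) ⬝ᵥ ψ (Ls j) = 1) (μ : ℝ)
    (hgs : ∀ j, dWaveSourceTorusTT' (Ls j) t' U μ h *ᵥ ψ (Ls j) =
      ((Matrix.groundEnergy (dWaveSourceTorusTT' (Ls j) t' U μ h) : ℝ) : ℂ) • ψ (Ls j)) (μ' : ℝ) :
    dWaveSourceEnergyDensityTT' t' U μ' h ≤ dWaveSourceEnergyDensityTT' t' U μ h - (μ' - μ) * ω.density :=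
  dWaveSourceEnergyDensityTT'_le_sub_mul_density_of_minimiser t' U h hω.isTranslationInvariant
    (hω.meanEnergy_sourced_eq_dWaveSourceEnergyDensityTT' hLs hψ t' U μ h hgs) μ'

/-- **`e_src` is non-increasing in `μ`** (densities are non-negative): `μ ≤ μ' ⇒ e_src(μ') ≤ e_src(μ)`, every
`t', U, h`. [cite: Ruelle1969, §3.4] -/
theorem dWaveSourceEnergyDensityTT'_antitone_mu {μ μ' : ℝ} (hle : μ ≤ μ') :
    dWaveSourceEnergyDensityTT' t' U μ' h ≤ dWaveSourceEnergyDensityTT' t' U μ h := by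
  obtain ⟨ω, hω, hωe⟩ := exists_re_expect_eq_dWaveSourceEnergyDensityTT' t' U μ h
  rw [ω.re_expect_dWaveSourceEnergyObsTT'] at hωe
  have h1 := dWaveSourceEnergyDensityTT'_le_sub_mul_density_of_minimiser t' U h hω hωe μ'
  nlinarith [ω.density_nonneg, sub_nonneg.2 hle]

/-- **One-sided Lipschitz step**: `e_src(μ) ≤ e_src(μ') + 2·(μ' − μ)` for `μ ≤ μ'` (densities are at most `2`).
[cite: Israel1979, Thm. I.3.4] -/
theorem dWaveSourceEnergyDensityTT'_le_add_two_mul {μ μ' : ℝ} (hle : μ ≤ μ') :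
    dWaveSourceEnergyDensityTT' t' U μ h ≤ dWaveSourceEnergyDensityTT' t' U μ' h + 2 * (μ' - μ) := by
  obtain ⟨ω, hω, hωe⟩ := exists_re_expect_eq_dWaveSourceEnergyDensityTT' t' U μ' h
  rw [ω.re_expect_dWaveSourceEnergyObsTT'] at hωe
  have h1 := dWaveSourceEnergyDensityTT'_le_sub_mul_density_of_minimiser t' U h hω hωe μ
  nlinarith [ω.density_le_two, sub_nonneg.2 hle]

/-- **`e_src` is `2`-Lipschitz in `μ`**: `|e_src(μ) − e_src(μ')| ≤ 2|μ − μ'|`, every `t', U, h`.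
[cite: Israel1979, Thm. I.3.4] -/
theorem abs_dWaveSourceEnergyDensityTT'_sub_mu_le (μ μ' : ℝ) :
    |dWaveSourceEnergyDensityTT' t' U μ h - dWaveSourceEnergyDensityTT' t' U μ' h| ≤ 2 * |μ - μ'| := by
  rcases le_total μ μ' with hle | hle
  · have h1 := dWaveSourceEnergyDensityTT'_antitone_mu t' U h hle
    have h2 := dWaveSourceEnergyDensityTT'_le_add_two_mul t' U h hle
    rw [abs_of_nonneg (by linarith), abs_of_nonpos (by linarith : μ - μ' ≤ 0)]
    linarith
  · have h1 := dWaveSourceEnergyDensityTT'_antitone_mu t' U h hle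
    have h2 := dWaveSourceEnergyDensityTT'_le_add_two_mul t' U h hle
    rw [abs_of_nonpos (by linarith : dWaveSourceEnergyDensityTT' t' U μ h - dWaveSourceEnergyDensityTT' t' U μ' h ≤ 0),
      abs_of_nonneg (by linarith : 0 ≤ μ - μ')]
    linarith

/-- **Window transport, FLOOR to smaller `μ`** (free): `lo ≤ e_src(μ) ⇒ lo ≤ e_src(μ')` for `μ' ≤ μ`.
[cite: Ruelle1969, §3.4] -/
theorem dWaveSourceEnergyDensityTT'_ge_of_ge_at_larger_mu {μ μ' lo : ℝ} (hle : μ' ≤ μ)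
    (hlo : lo ≤ dWaveSourceEnergyDensityTT' t' U μ h) : lo ≤ dWaveSourceEnergyDensityTT' t' U μ' h :=
  hlo.trans (dWaveSourceEnergyDensityTT'_antitone_mu t' U h hle)

/-- **Window transport, FLOOR to larger `μ`** (slope `2`): `lo ≤ e_src(μ) ⇒ lo − 2(μ' − μ) ≤ e_src(μ')` for `μ ≤ μ'`.
[cite: Israel1979, Thm. I.3.4] -/
theorem dWaveSourceEnergyDensityTT'_ge_of_ge_at_smaller_mu {μ μ' lo : ℝ} (hle : μ ≤ μ')
    (hlo : lo ≤ dWaveSourceEnergyDensityTT' t' U μ h) :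
    lo - 2 * (μ' - μ) ≤ dWaveSourceEnergyDensityTT' t' U μ' h := by
  linarith [dWaveSourceEnergyDensityTT'_le_add_two_mul t' U h hle]

/-- **Window transport, CEILING to larger `μ`** (free): `e_src(μ) ≤ hi ⇒ e_src(μ') ≤ hi` for `μ ≤ μ'`.
[cite: Ruelle1969, §3.4] -/
theorem dWaveSourceEnergyDensityTT'_le_of_le_at_smaller_mu {μ μ' hi : ℝ} (hle : μ ≤ μ')
    (hhi : dWaveSourceEnergyDensityTT' t' U μ h ≤ hi) : dWaveSourceEnergyDensityTT' t' U μ' h ≤ hi :=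
  (dWaveSourceEnergyDensityTT'_antitone_mu t' U h hle).trans hhi

/-- **Window transport, CEILING to smaller `μ`** (slope `2`): `e_src(μ) ≤ hi ⇒ e_src(μ') ≤ hi + 2(μ − μ')` for
`μ' ≤ μ`. [cite: Israel1979, Thm. I.3.4] -/
theorem dWaveSourceEnergyDensityTT'_le_of_le_at_larger_mu {μ μ' hi : ℝ} (hle : μ' ≤ μ)
    (hhi : dWaveSourceEnergyDensityTT' t' U μ h ≤ hi) :
    dWaveSourceEnergyDensityTT' t' U μ' h ≤ hi + 2 * (μ - μ') := by
  linarith [dWaveSourceEnergyDensityTT'_le_add_two_mul t' U h hle]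

end Mu

/-! ### §3 The `U`-direction: monotone, `1`-Lipschitz, tangents, window transport -/

section Repulsion

variable (t' μ h : ℝ)

/-- **The double-occupancy density of every state lies in `[0, 1]`**: `0 ≤ Re ω(n_{0↑}n_{0↓}) ≤ 1`
(`n_↑n_↓` and `n_↑(1 − n_↓)` are projections). [cite: BratteliRobinsonI1987, §2.3.2] -/
theorem InfVolFermionState.re_expect_docc_le_one (ω : InfVolFermionState 2) :
    (ω.expect {0} (nAt (0 : Site 2) (mem_singleton_self 0) 0 * nAt 0 (mem_singleton_self 0) 1)).re ≤ 1 :=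
  (ω.re_expect_nAt_mul_nAt_le).trans (ω.re_expect_nAt_le_one {0} (mem_singleton_self 0) 0)

/-- **Tangent inequality in `U` at a thermodynamic-limit ground state**: for every torus limit `ω` of unit
ground-state vectors of `A_L(t',U,μ,h)` and every real `U'`,
`e_src(t',U',μ,h) ≤ e_src(t',U,μ,h) + (U' − U)·D(ω)`, `D(ω) = Re ω(n_{0↑}n_{0↓})` the double-occupancy density
(`ω` is a trial state at `U'`; the `t–t'` mean energy is affine in `U` with slope `D`).
[cite: Israel1979, Thm. I.3.4] -/
theorem InfVolFermionState.IsTorusLimitOf.dWaveSourceEnergyDensityTT'_le_tangent_U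
    {ω : InfVolFermionState 2} {ψ : ∀ L, Fock (Orb (FermionTorus 2 L))} {Ls : ℕ → ℕ}
    [hL0 : ∀ j, NeZero (Ls j)] (hω : ω.IsTorusLimitOf ψ Ls) (hLs : Tendsto Ls atTop atTop)
    (hψ : ∀ j, star (ψ (Ls j)) ⬝ᵥ ψ (Ls j) = 1) (U : ℝ)
    (hgs : ∀ j, dWaveSourceTorusTT' (Ls j) t' U μ h *ᵥ ψ (Ls j) =
      ((Matrix.groundEnergy (dWaveSourceTorusTT' (Ls j) t' U μ h) : ℝ) : ℂ) • ψ (Ls j)) (U' : ℝ) :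
    dWaveSourceEnergyDensityTT' t' U' μ h ≤ dWaveSourceEnergyDensityTT' t' U μ h +
      (U' - U) * (ω.expect {0} (nAt (0 : Site 2) (mem_singleton_self 0) 0 * nAt 0 (mem_singleton_self 0) 1)).re := by
  have hTI := hω.isTranslationInvariant
  have hmin := hω.meanEnergy_sourced_eq_dWaveSourceEnergyDensityTT' hLs hψ t' U μ h hgs
  have h1 := dWaveSourceEnergyDensityTT'_le_meanEnergy_sourced t' U' μ h hTI
  rw [InfVolFermionState.meanEnergy_hubbardTTPrimeSourced] at h1 hmin
  rw [ω.meanEnergy_hubbardTTPrime_affine 1 t' U t' U', sub_self, zero_mul, add_zero,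
    hω.meanEnergy_onSite_eq_re_expect_docc hLs] at h1
  linarith

/-- **`e_src` is non-decreasing in `U`** (every real `U ≤ U'`; the double-occupancy density is non-negative).
[cite: Ruelle1969, §3.4] -/
theorem dWaveSourceEnergyDensityTT'_mono_U {U U' : ℝ} (hle : U ≤ U') :
    dWaveSourceEnergyDensityTT' t' U μ h ≤ dWaveSourceEnergyDensityTT' t' U' μ h := by
  haveI hL0 : ∀ j : ℕ, NeZero (j + 1) := fun j => ⟨Nat.succ_ne_zero j⟩
  obtain ⟨ψ, φ, ω, hφ, hgs, hψ1, hω, -⟩ :=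
    exists_isTorusLimitOf_dWaveSourceGroundStates t' U' μ h (Ls := fun j : ℕ => j + 1) (tendsto_add_atTop_nat 1)
  have hLφ : Tendsto (fun j => φ j + 1) atTop atTop := (tendsto_add_atTop_nat 1).comp hφ.tendsto_atTop
  haveI hL0' : ∀ j : ℕ, NeZero (φ j + 1) := fun j => hL0 (φ j)
  have hω' : ω.IsTorusLimitOf ψ (fun j => φ j + 1) := hω
  have h1 := hω'.dWaveSourceEnergyDensityTT'_le_tangent_U t' μ h hLφ (fun j => hψ1 (φ j)) U'
    (fun j => hgs (φ j)) U
  nlinarith [ω.re_expect_docc_nonneg, sub_nonneg.2 hle]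

/-- **One-sided Lipschitz step**: `e_src(U') ≤ e_src(U) + (U' − U)` for `U ≤ U'` (`D ≤ 1`).
[cite: Israel1979, Thm. I.3.4] -/
theorem dWaveSourceEnergyDensityTT'_le_add_sub_U {U U' : ℝ} (hle : U ≤ U') :
    dWaveSourceEnergyDensityTT' t' U' μ h ≤ dWaveSourceEnergyDensityTT' t' U μ h + (U' - U) := by
  haveI hL0 : ∀ j : ℕ, NeZero (j + 1) := fun j => ⟨Nat.succ_ne_zero j⟩
  obtain ⟨ψ, φ, ω, hφ, hgs, hψ1, hω, -⟩ :=
    exists_isTorusLimitOf_dWaveSourceGroundStates t' U μ h (Ls := fun j : ℕ => j + 1) (tendsto_add_atTop_nat 1)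
  have hLφ : Tendsto (fun j => φ j + 1) atTop atTop := (tendsto_add_atTop_nat 1).comp hφ.tendsto_atTop
  haveI hL0' : ∀ j : ℕ, NeZero (φ j + 1) := fun j => hL0 (φ j)
  have hω' : ω.IsTorusLimitOf ψ (fun j => φ j + 1) := hω
  have h1 := hω'.dWaveSourceEnergyDensityTT'_le_tangent_U t' μ h hLφ (fun j => hψ1 (φ j)) U
    (fun j => hgs (φ j)) U'
  nlinarith [ω.re_expect_docc_le_one, sub_nonneg.2 hle]

/-- **`e_src` is `1`-Lipschitz in `U`**: `|e_src(U) − e_src(U')| ≤ |U − U'|`, every real `U, U'`, `t', μ, h`.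
[cite: Israel1979, Thm. I.3.4] -/
theorem abs_dWaveSourceEnergyDensityTT'_sub_U_le (U U' : ℝ) :
    |dWaveSourceEnergyDensityTT' t' U μ h - dWaveSourceEnergyDensityTT' t' U' μ h| ≤ |U - U'| := by
  rcases le_total U U' with hle | hle
  · have h1 := dWaveSourceEnergyDensityTT'_mono_U t' μ h hle
    have h2 := dWaveSourceEnergyDensityTT'_le_add_sub_U t' μ h hle
    rw [abs_of_nonpos (by linarith : dWaveSourceEnergyDensityTT' t' U μ h - dWaveSourceEnergyDensityTT' t' U' μ h ≤ 0),
      abs_of_nonpos (by linarith : U - U' ≤ 0)]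
    linarith
  · have h1 := dWaveSourceEnergyDensityTT'_mono_U t' μ h hle
    have h2 := dWaveSourceEnergyDensityTT'_le_add_sub_U t' μ h hle
    rw [abs_of_nonneg (by linarith : 0 ≤ dWaveSourceEnergyDensityTT' t' U μ h - dWaveSourceEnergyDensityTT' t' U' μ h),
      abs_of_nonneg (by linarith : 0 ≤ U - U')]
    linarith

/-- **Window transport, FLOOR to larger `U`** (free): `lo ≤ e_src(U) ⇒ lo ≤ e_src(U')` for `U ≤ U'`.
[cite: Ruelle1969, §3.4] -/
theorem dWaveSourceEnergyDensityTT'_ge_of_ge_at_smaller_U {U U' lo : ℝ} (hle : U ≤ U')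
    (hlo : lo ≤ dWaveSourceEnergyDensityTT' t' U μ h) : lo ≤ dWaveSourceEnergyDensityTT' t' U' μ h :=
  hlo.trans (dWaveSourceEnergyDensityTT'_mono_U t' μ h hle)

/-- **Window transport, CEILING to smaller `U`** (free): `e_src(U') ≤ hi ⇒ e_src(U) ≤ hi` for `U ≤ U'`.
[cite: Ruelle1969, §3.4] -/
theorem dWaveSourceEnergyDensityTT'_le_of_le_at_larger_U {U U' hi : ℝ} (hle : U ≤ U')
    (hhi : dWaveSourceEnergyDensityTT' t' U' μ h ≤ hi) : dWaveSourceEnergyDensityTT' t' U μ h ≤ hi :=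
  (dWaveSourceEnergyDensityTT'_mono_U t' μ h hle).trans hhi

/-- **Window transport, CEILING to larger `U`** (slope `1`): `e_src(U) ≤ hi ⇒ e_src(U') ≤ hi + (U' − U)` for
`U ≤ U'`. [cite: Israel1979, Thm. I.3.4] -/
theorem dWaveSourceEnergyDensityTT'_le_of_le_at_smaller_U {U U' hi : ℝ} (hle : U ≤ U')
    (hhi : dWaveSourceEnergyDensityTT' t' U μ h ≤ hi) :
    dWaveSourceEnergyDensityTT' t' U' μ h ≤ hi + (U' - U) := by
  linarith [dWaveSourceEnergyDensityTT'_le_add_sub_U t' μ h hle]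

/-- **Window transport, FLOOR to smaller `U`** (slope `1`): `lo ≤ e_src(U') ⇒ lo − (U' − U) ≤ e_src(U)` for
`U ≤ U'`. [cite: Israel1979, Thm. I.3.4] -/
theorem dWaveSourceEnergyDensityTT'_ge_of_ge_at_larger_U {U U' lo : ℝ} (hle : U ≤ U')
    (hlo : lo ≤ dWaveSourceEnergyDensityTT' t' U' μ h) :
    lo - (U' - U) ≤ dWaveSourceEnergyDensityTT' t' U μ h := by
  linarith [dWaveSourceEnergyDensityTT'_le_add_sub_U t' μ h hle]

end Repulsion

end Literature.MathematicalPhysics.QuantumLattice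

end
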